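/-
Origin: expansion seat `planner-pub-hodgecm-pv11-g9-0`, handover TWO rewrites: `^import Pv11g9\.` -> `import HodgeCM.PerL34.` (x1: `import Pv11g9.PrintedLinEndState` -> `import HodgeCM.PerL34.PrintedLinEndState`, my row #4 r30 8f93ee24 (v2)) and `^import Pv06g6\.` -> `import HodgeCM.PerL34.` (x1: `import Pv06g6.ArchCOrbit` -> `import HodgeCM.PerL34.ArchCOrbit`, pv06-g6 #1 r30 e5dc59d7 (v2; v1 f4521912)) ; after HodgeCM/PerL34/PrintedLinEndState.lean (pv11-g9 #4 (`HOME/pub-hodgecm-pv11-g9/lean/Pv11g9/PrintedOrbitEndState.lean`, md5 49cb8416, 709 lines);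
landed by the gen-8 packager in gate run 30 as `HodgeCM/PerL34/PrintedOrbitEndState.lean` (import ^import Pv06g6\.ArchCOrbit[ \t]*$→import HodgeCM.PerL34.ArchCOrbit ×1; import ^import Pv11g9\.PrintedLinEndState[ \t]*$→import HodgeCM.PerL34.PrintedLinEndState ×1).
-/
/-
Copyright: pub-hodgecm cell, unit pub-hodgecm-pv11-g9 (DAG-NODE PROVER #11, gen 9), node #5. Mathlib + tree only.
Origin / target: `HOME/pub-hodgecm-pv11-g9/lean/Pv11g9/PrintedOrbitEndState.lean` → `HodgeCM/PerL34/PrintedOrbitEndState.lean`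
(imports this seat's node #4 `Pv11g9.PrintedLinEndState` → tree `HodgeCM.PerL34.PrintedLinEndState`, rewrite `^import Pv11g9\.`
↦ `import HodgeCM.PerL34.`; and pv06-g6's `Pv06g6.ArchCOrbit` (HANDOVER #1 12:55:16Z, f4521912) → tree
`HodgeCM.PerL34.ArchCOrbit`, rewrite `^import Pv06g6\.` ↦ `import HodgeCM.PerL34.`).
-/
import Summits.HodgeConjecture.HodgeCM.PerL34.PrintedLinEndState_2
import Summits.HodgeConjecture.HodgeCM.PerL34.ArchCOrbit_3

/-!
# N29 on the END STATE without the Gårding block: `occ` from ELEVEN operator-side / NINE linear fields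

PerL v5 (tex blob d912a121) proves Lemma 4.1(c) (ll. 488–490) at l. 517 through smooth vectors of `σ̂_i`
(`⟨ω(X)φ ⊗ Φ_f, v⟩ = −⟨φ ⊗ Φ_f, dR(X)v⟩` on Gårding vectors; dictionary entry [SETUP D7]).  pv06-g6's `ArchCOrbit` (RUN 30)
replaces that step by the ORBIT ARGUMENT — if the whole `ω`-orbit of `φ ⊗ Φ_f` annihilates `σ̂_i` at a point then so does
`(X_jφ) ⊗ Φ_f`, because `s ↦ 𝒯_{ω(e_j s)(φ⊗Φ_f)}(·)(p)` has derivative `𝒯_{(X_jφ)⊗Φ_f}(·)(p)` at `0` ([SETUP D5] `hF`: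
a Fréchet/Schwartz-topology C¹ statement [SETUP D5′]: Poulsen 1972 (J. Funct. Anal. 9) Prop. 1.2, p. 93 — the orbit map of a
D_∞-vector is C^∞ into D_∞ with Goodman's Fréchet topology — plus the identification of that topology on 𝒮 with the Schwartz
topology (print locator still to be named, adv2g34-O14); Folland 1989 Thm. (4.45) / Prop. (4.49) give only the VALUE of the
derivative) and the derivative of the zero function is zero
— in the D-free chart `ArchC.OrbitCore C P` (= pv08-g3's `ArchCCore` with the six Gårding fields replaced by
`orbit_stable`), KERNEL `orbit_stable_of_hasDerivAt`, `OrbitCore.eigen_of_detected`.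

THIS LEAF puts the orbit chart on the END STATE `T∘ := ThetaModel.ofRegCarrier (C.rtc R12 R34) hA` of prl1-g4's core, in
the two structure disciplines of this seat's nodes #3 and #4:
* §1 (generic) `ArchC.OpOrbitSide` = node #3's eighteen-field `OpAnalyticSide` MINUS the seven [SETUP D7] fields `he`,
  `Sm`, `Sm_sub`, `Sm_dense`, `YR`, `YR_mem`, `hH` — ELEVEN fields {`FinIdx`, bare `ins`, `ins_add`, `ins_smul`, `op_dense`,
  `omg_ins`, `ιR`, `XR`, `e`, `ladder_span`, `hF`}, no structure on `𝒮^κ`; `OpOrbitSide.toOrbitCore (hinv) : OrbitCore C P`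
  (`pure_detect` := node #3 `pure_detect_of_opDense`, `orbit_stable` := pv06-g6 `orbit_stable_of_hasDerivAt`, `gen` /
  `φ₀_eigen` := pv12 `gen_format_of_mem_span` / `ωT_φ₀` + `printPlacesW_loc`), `eigen_of_detected`, `occ_of_wOccurs`,
  `occLeaf`; `ArchC.LinOrbitSide` = node #4's sixteen-field `LinearSide` minus the same seven — NINE fields {`FinIdx`, linear
  `ins`, `dense`, `omg_ins`, `ιR`, `XR`, `e`, `ladder_span`, `hF`} over `[AddCommGroup SK] [Module ℂ SK]`; `LinOrbitSide.toOp`;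
  forgetful `OpAnalyticSide.toOrbit`, `LinearSide.toLinOrbit` (the new inputs are implied by the old).
* §2 (end state) `OpOrbitCore12/34` (kind, scalings, an `OpOrbitSide` over `T∘.core V c` at the canonical points and charts),
  `H_occ` (N21 := node #2 `invariance`; occurrence := node #1 `t12_/t34_wOccurs_of_printedEigenvector`),
  **`Open_occ_of_opOrbitCores`**, `N29_occ_of_opOrbitCores`, `OpOrbitCore12.ofOp` (node #3's input ⇒ this one);
  under pv02-g7's `[(C.wm V c).LinearStr]`: `LinOrbitCore12/34`, `toOp` (node #4 `TΦc_add_of_linear` / `TΦc_smul_of_linear`,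
  node #3 `continuous_TΦc`), `H_occ`, **`Open_occ_of_linOrbitCores`**, `LinOrbitCore12.ofLin`.
* §3 the same on prl1-g5's `C₀.thetaModel h d12 d34`; §4 `Assembly.perL_ofSignRecipe₀_opOrbitCores / _linOrbitCores : … →
  U.PerL` (+ `realisationExists`, `COR_CM`).

HONEST LABEL.  REDUCTION (pv06-g6's, transported): per good context and pair the END-STATE input `occ` is now a kind map,
scalings and ELEVEN structure-free [SETUP D4/D5] statements (NINE under `LinearStr`) — pure tensors with operator
identities / density and torus equivariance, real directions spanning the printed ladder operators, curves `e_j` with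
the Fock-side derivative `hF`.  The Gårding package [SETUP D7] has left the end-state input.  Nothing of this archimedean
content is proved here; no new constants, no `axiom`, complete proofs.
-/

set_option autoImplicit false

noncomputable section

open MeasureTheory

namespace HodgeCM

/-! ## §1  The D7-free sides (generic) -/

namespace PerL34
namespace ArchC

open HodgeCM.Prior.Perl34File HodgeCM.Prior.Perl34File.Perl34
open HodgeCM.PerL34.Fock HodgeCM.PerL34.Fock.PrintDict

section Orb

variable {H HG CG G SK SigIdx SigIdxG : Type*}
variable [NormedAddCommGroup H] [InnerProductSpace ℂ H] [CompleteSpace H]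
variable [NormedAddCommGroup HG] [InnerProductSpace ℂ HG] [CompleteSpace HG]
variable [NormedAddCommGroup CG] [NormedSpace ℂ CG]
variable [Group G] [TopologicalSpace G] [TopologicalSpace SK]

/-- **The D7-free OPERATOR-SIDE printed side**: node #3's `OpAnalyticSide` minus `he`, `Sm`, `Sm_sub`, `Sm_dense`, `YR`,
`YR_mem`, `hH`.  ELEVEN fields, verbatim; none mentions a structure on `𝒮^κ`, the torus datum, N21, `cont` or `σ̂_i`'s
smooth vectors. -/
structure OpOrbitSide (C : IsolationCore H HG CG G SK SigIdx SigIdxG) (P : C4a.PointedCore C)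
    (RP : Type) [Fintype RP] [DecidableEq RP] (kind : RP → PlaceKind) (lam : RP → ℂ)
    (hlam : ∀ b, lam b ≠ 0) (vac : RP → (Circle × Circle →* Circle))
    (ιT : (printPlaces RP kind lam hlam vac).Tg →* G) where
  /-- [SETUP D4] index of the fixed data at the other places: Φ_f ∈ 𝒮((V₃⊗W)(𝔸_f)). -/
  FinIdx : Type
  /-- [SETUP D4] the pure tensor φ ↦ φ ⊗ Φ_f ∈ 𝒮^κ (bare map). -/
  ins : FinIdx → (printPlaces RP kind lam hlam vac).F → SK
  /-- [SETUP D4] φ ↦ 𝒯_{φ⊗Φ_f} is additive (as operators L²([U(W)]) → C([G_U])). -/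
  ins_add : ∀ (f : FinIdx) (φ ψ : (printPlaces RP kind lam hlam vac).F),
    C.TΦc (ins f (φ + ψ)) = C.TΦc (ins f φ) + C.TΦc (ins f ψ)
  /-- [SETUP D4] φ ↦ 𝒯_{φ⊗Φ_f} is homogeneous. -/
  ins_smul : ∀ (f : FinIdx) (c : ℂ) (φ : (printPlaces RP kind lam hlam vac).F),
    C.TΦc (ins f (c • φ)) = c • C.TΦc (ins f φ)
  /-- [SETUP D4/D5] operator-side density: `𝒯_Φ` is an operator-norm limit of ℂ-combinations of the `𝒯_{φ⊗Φ_f}`. -/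
  op_dense : ∀ Φ : SK, C.TΦc Φ ∈ (Submodule.span ℂ
    (Set.range fun q : FinIdx × (printPlaces RP kind lam hlam vac).F => C.TΦc (ins q.1 q.2))).topologicalClosure
  /-- [SETUP D4] ω(t)(φ ⊗ Φ_f) = (ω_∞(t)φ) ⊗ Φ_f (printed scalings, PINNED vacuum characters). -/
  omg_ins : ∀ (f : FinIdx) (t : (printPlaces RP kind lam hlam vac).Tg) (φ : (printPlaces RP kind lam hlam vac).F),
    C.omg (ιT t) (ins f φ) = ins f ((printPlaces RP kind lam hlam vac).ωT t φ)
  /-- [SETUP D5] index of a family of REAL directions X_j ∈ 𝔲(W)(L₀⊗ℝ). -/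
  ιR : Type
  /-- [SETUP D5] ω_∞(X_j) on 𝓕^κ_∞. -/
  XR : ιR → (printPlaces RP kind lam hlam vac).F →ₗ[ℂ] (printPlaces RP kind lam hlam vac).F
  /-- [SETUP D4] a curve e_j : ℝ → U(W)(𝔸) (intended exp(sX_j); only its derivative datum `hF` is consumed). -/
  e : ιR → ℝ → G
  /-- [SETUP D5] every printed slot / ladder operator is a ℂ-combination of the real directions. -/
  ladder_span : ∀ k : (printPlaces RP kind lam hlam vac).ιX,
    (printPlaces RP kind lam hlam vac).X k ∈ Submodule.span ℂ (Set.range XR)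
  /-- [SETUP D5′] s ↦ 𝒯_{ω(e_j s)(φ⊗Φ_f)}(·)(g) has derivative 𝒯_{(X_jφ)⊗Φ_f}(·)(g) at 0 in operator norm — i.e.
  s ↦ ω(e_j s)(φ⊗Φ_f) is differentiable at 0 in the topology of 𝒮^κ in which Φ ↦ 𝒯_Φ(·)(g) is continuous (Schwartz /
  Fréchet, NOT L²): Poulsen 1972 Prop. 1.2 (p. 93) + the identification of Goodman's D_∞ topology on 𝒮 with the Schwartz
  topology (locator to be named, adv2g34-O14); Folland 1989 Thm. (4.45) / Prop. (4.49) only for the VALUE dω(X_j). -/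
  hF : ∀ (j : ιR) (f : FinIdx) (φ : (printPlaces RP kind lam hlam vac).F) (p : P.Pt),
    HasDerivAt (fun s : ℝ => C4a.pointFunctional C P (C.omg (e j s) (ins f φ)) p)
      (C4a.pointFunctional C P (ins f (XR j φ)) p) 0

namespace OpOrbitSide

variable {C : IsolationCore H HG CG G SK SigIdx SigIdxG} {P : C4a.PointedCore C}
variable {RP : Type} [Fintype RP] [DecidableEq RP] {kind : RP → PlaceKind} {lam : RP → ℂ} {hlam : ∀ b, lam b ≠ 0}
  {vac : RP → (Circle × Circle →* Circle)} {ιT : (printPlaces RP kind lam hlam vac).Tg →* G}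

/-- **pv06-g6's D-free, D7-free chart `OrbitCore C P` for the PRINTED torus, from the operator-side data plus N21**
(`hinv`; on the end state node #2's theorem): `ιX := ιR`, `X := XR`, `w := printPlacesW`, `pure_detect` := node #3
`pure_detect_of_opDense`, `orbit_stable` := pv06-g6 `orbit_stable_of_hasDerivAt` from `hF`, `gen` := pv12
`gen_format_of_mem_span` from `ladder_span`, `φ₀_eigen` := pv12 `ωT_φ₀` + `printPlacesW_loc`. -/
def toOrbitCore (A : OpOrbitSide C P RP kind lam hlam vac ιT)
    (hinv : ∀ (h : G) (Φ : SK) (v : H), C.TΦc (C.omg h Φ) (C.R h v) = C.TΦc Φ v) : OrbitCore C P where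
  F := (printPlaces RP kind lam hlam vac).F
  ιX := A.ιR
  X := A.XR
  Tg := (printPlaces RP kind lam hlam vac).Tg
  ιT := ιT
  w := printPlacesW RP kind lam hlam vac
  w_norm := printPlacesW_norm RP kind lam hlam vac
  ωT := (printPlaces RP kind lam hlam vac).ωT
  FinIdx := A.FinIdx
  ins := A.ins
  φ₀ := (printPlaces RP kind lam hlam vac).φ₀
  ins_add := A.ins_add
  ins_smul := A.ins_smul
  omg_ins := A.omg_ins
  invariance := hinv
  pure_detect := pure_detect_of_opDense A.ins A.op_dense
  orbit_stable := orbit_stable_of_hasDerivAt A.ins (fun j φ => A.XR j φ) A.e A.hF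
  gen := (printPlaces RP kind lam hlam vac).gen_format_of_mem_span A.XR A.ladder_span
  φ₀_eigen := fun t => by rw [(printPlaces RP kind lam hlam vac).ωT_φ₀, printPlacesW_loc RP kind lam hlam vac]

/-- Read-back (`rfl`): the chart's torus map IS `ιT`. -/
theorem toOrbitCore_ιT (A : OpOrbitSide C P RP kind lam hlam vac ιT)
    (hinv : ∀ (h : G) (Φ : SK) (v : H), C.TΦc (C.omg h Φ) (C.R h v) = C.TΦc Φ v) :
    (A.toOrbitCore hinv).ιT = ιT := rfl

/-- Read-back (`rfl`): the chart's character IS the printed weight. -/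
theorem toOrbitCore_w (A : OpOrbitSide C P RP kind lam hlam vac ιT)
    (hinv : ∀ (h : G) (Φ : SK) (v : H), C.TΦc (C.omg h Φ) (C.R h v) = C.TΦc Φ v) :
    (A.toOrbitCore hinv).w = printPlacesW RP kind lam hlam vac := rfl

/-- Read-back (`rfl`): the chart's pure tensors ARE `ins`. -/
theorem toOrbitCore_ins (A : OpOrbitSide C P RP kind lam hlam vac ιT)
    (hinv : ∀ (h : G) (Φ : SK) (v : H), C.TΦc (C.omg h Φ) (C.R h v) = C.TΦc Φ v) :
    (A.toOrbitCore hinv).ins = A.ins := rfl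

/-- **Detected ⊆ Eigen for the printed torus, D7-free** (pv06-g6 `OrbitCore.eigen_of_detected` on `toOrbitCore`). -/
theorem eigen_of_detected (A : OpOrbitSide C P RP kind lam hlam vac ιT)
    (hinv : ∀ (h : G) (Φ : SK) (v : H), C.TΦc (C.omg h Φ) (C.R h v) = C.TΦc Φ v)
    (Φ : SK) (i : SigIdx) (h : ∃ v ∈ C.hatσ i, C.TΦ Φ v ≠ 0) :
    ∃ y ∈ C.hatσ i, y ≠ 0 ∧ ∀ t : (printPlaces RP kind lam hlam vac).Tg,
      C.R (ιT t) y = printPlacesW RP kind lam hlam vac t • y :=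
  (A.toOrbitCore hinv).eigen_of_detected Φ i h

/-- **Lemma 4.1(c) in `H_occ` shape for any occurrence predicate `W` that reads printed eigenvectors.** -/
theorem occ_of_wOccurs (A : OpOrbitSide C P RP kind lam hlam vac ιT)
    (hinv : ∀ (h : G) (Φ : SK) (v : H), C.TΦc (C.omg h Φ) (C.R h v) = C.TΦc Φ v)
    {W : SigIdx → Prop}
    (hW : ∀ i : SigIdx, (∃ y ∈ C.hatσ i, y ≠ 0 ∧ ∀ t : (printPlaces RP kind lam hlam vac).Tg,
      C.R (ιT t) y = printPlacesW RP kind lam hlam vac t • y) → W i) :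
    ∀ (Φ : SK) (i : SigIdx), (∃ v ∈ C.hatσ i, C.TΦ Φ v ≠ 0) → W i :=
  fun Φ i h => hW i (A.eigen_of_detected hinv Φ i h)

/-- … hence the S4 leaf `OccLeaf C D` for any torus datum whose `wOccurs` reads printed eigenvectors (pv06-g6
`OrbitCore.occLeaf`). -/
theorem occLeaf (A : OpOrbitSide C P RP kind lam hlam vac ιT)
    (hinv : ∀ (h : G) (Φ : SK) (v : H), C.TΦc (C.omg h Φ) (C.R h v) = C.TΦc Φ v) (D : TorusData C)
    (hD : ∀ i : SigIdx, (∃ y ∈ C.hatσ i, y ≠ 0 ∧ ∀ t : (printPlaces RP kind lam hlam vac).Tg,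
      C.R (ιT t) y = printPlacesW RP kind lam hlam vac t • y) → D.wOccurs i) :
    OccLeaf C D :=
  (A.toOrbitCore hinv).occLeaf D hD

end OpOrbitSide

/-- **Node #3's operator side gives the D7-free one** (forget the seven Gårding fields): the new input is implied by
the old. -/
def OpAnalyticSide.toOrbit {C : IsolationCore H HG CG G SK SigIdx SigIdxG} {P : C4a.PointedCore C}
    {RP : Type} [Fintype RP] [DecidableEq RP] {kind : RP → PlaceKind} {lam : RP → ℂ} {hlam : ∀ b, lam b ≠ 0}
    {vac : RP → (Circle × Circle →* Circle)} {ιT : (printPlaces RP kind lam hlam vac).Tg →* G}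
    (A : OpAnalyticSide C P RP kind lam hlam vac ιT) : OpOrbitSide C P RP kind lam hlam vac ιT where
  FinIdx := A.FinIdx
  ins := A.ins
  ins_add := A.ins_add
  ins_smul := A.ins_smul
  op_dense := A.op_dense
  omg_ins := A.omg_ins
  ιR := A.ιR
  XR := A.XR
  e := A.e
  ladder_span := A.ladder_span
  hF := A.hF

/-- **The D7-free LINEAR printed side**: node #4's `LinearSide` minus the seven Gårding fields — NINE fields over a
ℂ-vector-space structure on `𝒮^κ` given as instance PARAMETERS. -/
structure LinOrbitSide (C : IsolationCore H HG CG G SK SigIdx SigIdxG) (P : C4a.PointedCore C)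
    (RP : Type) [Fintype RP] [DecidableEq RP] (kind : RP → PlaceKind) (lam : RP → ℂ)
    (hlam : ∀ b, lam b ≠ 0) (vac : RP → (Circle × Circle →* Circle))
    (ιT : (printPlaces RP kind lam hlam vac).Tg →* G) [AddCommGroup SK] [Module ℂ SK] where
  /-- [SETUP D4] index of the fixed data at the other places. -/
  FinIdx : Type
  /-- [SETUP D4] the pure tensor φ ↦ φ ⊗ Φ_f ∈ 𝒮^κ, linear in φ. -/
  ins : FinIdx → (printPlaces RP kind lam hlam vac).F →ₗ[ℂ] SK
  /-- [SETUP D4/D5] the pure tensors span a dense subspace of 𝒮^κ. -/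
  dense : Dense (Submodule.span ℂ
    (Set.range fun q : FinIdx × (printPlaces RP kind lam hlam vac).F => ins q.1 q.2) : Set SK)
  /-- [SETUP D4] ω(t)(φ ⊗ Φ_f) = (ω_∞(t)φ) ⊗ Φ_f. -/
  omg_ins : ∀ (f : FinIdx) (t : (printPlaces RP kind lam hlam vac).Tg) (φ : (printPlaces RP kind lam hlam vac).F),
    C.omg (ιT t) (ins f φ) = ins f ((printPlaces RP kind lam hlam vac).ωT t φ)
  /-- [SETUP D5] index of a family of REAL directions. -/
  ιR : Type
  /-- [SETUP D5] ω_∞(X_j) on 𝓕^κ_∞. -/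
  XR : ιR → (printPlaces RP kind lam hlam vac).F →ₗ[ℂ] (printPlaces RP kind lam hlam vac).F
  /-- [SETUP D4] the curves e_j : ℝ → U(W)(𝔸). -/
  e : ιR → ℝ → G
  /-- [SETUP D5] every printed slot / ladder operator is a ℂ-combination of the real directions. -/
  ladder_span : ∀ k : (printPlaces RP kind lam hlam vac).ιX,
    (printPlaces RP kind lam hlam vac).X k ∈ Submodule.span ℂ (Set.range XR)
  /-- [SETUP D5′] the Fock-side derivative along e_j at 0 (Schwartz-topology C¹ statement: Poulsen 1972 Prop. 1.2 +
  topology identification, adv2g34-O14; Folland (4.45)/(4.49) for the value only). -/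
  hF : ∀ (j : ιR) (f : FinIdx) (φ : (printPlaces RP kind lam hlam vac).F) (p : P.Pt),
    HasDerivAt (fun s : ℝ => C4a.pointFunctional C P (C.omg (e j s) (ins f φ)) p)
      (C4a.pointFunctional C P (ins f (XR j φ)) p) 0

/-- The operator-side D7-free side from the linear one plus the two linearity laws and operator-norm continuity of
`Φ ↦ 𝒯_Φ` (`op_dense` := node #3 `opDense_of_dense`). -/
def LinOrbitSide.toOp [AddCommGroup SK] [Module ℂ SK] {C : IsolationCore H HG CG G SK SigIdx SigIdxG}
    {P : C4a.PointedCore C} {RP : Type} [Fintype RP] [DecidableEq RP] {kind : RP → PlaceKind} {lam : RP → ℂ}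
    {hlam : ∀ b, lam b ≠ 0} {vac : RP → (Circle × Circle →* Circle)} {ιT : (printPlaces RP kind lam hlam vac).Tg →* G}
    (A : LinOrbitSide C P RP kind lam hlam vac ιT)
    (TΦc_add : ∀ Φ Ψ : SK, C.TΦc (Φ + Ψ) = C.TΦc Φ + C.TΦc Ψ)
    (TΦc_smul : ∀ (c : ℂ) (Φ : SK), C.TΦc (c • Φ) = c • C.TΦc Φ)
    (hTc : Continuous fun Φ : SK => C.TΦc Φ) : OpOrbitSide C P RP kind lam hlam vac ιT where
  FinIdx := A.FinIdx
  ins := fun f φ => A.ins f φ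
  ins_add := fun f φ ψ => by
    show C.TΦc (A.ins f (φ + ψ)) = C.TΦc (A.ins f φ) + C.TΦc (A.ins f ψ)
    rw [map_add, TΦc_add]
  ins_smul := fun f c φ => by
    show C.TΦc (A.ins f (c • φ)) = c • C.TΦc (A.ins f φ)
    rw [LinearMap.map_smul, TΦc_smul]
  op_dense := opDense_of_dense TΦc_add TΦc_smul hTc (fun f φ => A.ins f φ) A.dense
  omg_ins := A.omg_ins
  ιR := A.ιR
  XR := A.XR
  e := A.e
  ladder_span := A.ladder_span
  hF := A.hF

/-- **Node #4's linear side gives the D7-free one** (forget the seven Gårding fields). -/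
def LinearSide.toLinOrbit [AddCommGroup SK] [Module ℂ SK] {C : IsolationCore H HG CG G SK SigIdx SigIdxG}
    {P : C4a.PointedCore C} {RP : Type} [Fintype RP] [DecidableEq RP] {kind : RP → PlaceKind} {lam : RP → ℂ}
    {hlam : ∀ b, lam b ≠ 0} {vac : RP → (Circle × Circle →* Circle)} {ιT : (printPlaces RP kind lam hlam vac).Tg →* G}
    (A : LinearSide C P RP kind lam hlam vac ιT) : LinOrbitSide C P RP kind lam hlam vac ιT where
  FinIdx := A.FinIdx
  ins := A.ins
  dense := A.dense
  omg_ins := A.omg_ins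
  ιR := A.ιR
  XR := A.XR
  e := A.e
  ladder_span := A.ladder_span
  hF := A.hF

end Orb

end ArchC
end PerL34

/-! ## §2  On the END STATE: `Open_occ` from D7-free printed cores -/

namespace Universe

namespace AdelicTorusCore

open HodgeCM.PerL34 HodgeCM.PerL34.ArchC HodgeCM.PerL34.Fock HodgeCM.PerL34.Fock.PrintDict
open HodgeCM.Prior.Perl34File HodgeCM.Prior.Perl34File.Perl34
open NumberField NumberField.SeesawArchTorus

variable {U : Universe} {hP : PrintFact_unitaryCompact} (C : U.AdelicTorusCore hP)
  (R12 : ∀ {L : CMField} {ι₁ : L →+* ℂ} (V : HermSpace3 L ι₁) (c : SeesawCtx L), C.Rest12 V c)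
  (R34 : ∀ {L : CMField} {ι₁ : L →+* ℂ} (V : HermSpace3 L ι₁) (c : SeesawCtx L), C.Rest34 V c)
  (hA : (C.rtc R12 R34).Analytic)

section OpenOcc

/-- **The (12) D7-free OPERATOR-SIDE printed core of a context on the END STATE**: a kind map, scalings, and an eleven-field
`OpOrbitSide` over `T∘.core V c` at the canonical points (node #2) and the canonical (12) chart (node #1). -/
structure OpOrbitCore12 {L : CMField} {ι₁ : L →+* ℂ} (V : HermSpace3 L ι₁) (c : SeesawCtx L) where
  /-- decidable equality of the infinite places (any instance; used only to form the printed places) -/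
  [decEq : DecidableEq (InfinitePlace (L : Type))]
  /-- the kind `Σ₁₂ / D₁₂ / ι₁` of each infinite place -/
  kind : InfinitePlace (L : Type) → PlaceKind
  /-- the printed scalings `λ_b ≠ 0` -/
  lam : InfinitePlace (L : Type) → ℂ
  hlam : ∀ w, lam w ≠ 0
  /-- the D7-free operator-side side at the canonical points and the canonical (12) chart -/
  side : OpOrbitSide ((ThetaModel.ofRegCarrier (C.rtc R12 R34) hA).core V c) (C.pointedCore R12 R34 hA V c)
    (InfinitePlace (L : Type)) kind lam hlam (pinnedVacs kind (R12 V c).m₁ (R12 V c).m₂)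
    (C.chart12 R12 V c kind lam hlam)

/-- **The (34) D7-free OPERATOR-SIDE printed core of a context on the END STATE.** -/
structure OpOrbitCore34 {L : CMField} {ι₁ : L →+* ℂ} (V : HermSpace3 L ι₁) (c : SeesawCtx L) where
  [decEq : DecidableEq (InfinitePlace (L : Type))]
  kind : InfinitePlace (L : Type) → PlaceKind
  lam : InfinitePlace (L : Type) → ℂ
  hlam : ∀ w, lam w ≠ 0
  side : OpOrbitSide ((ThetaModel.ofRegCarrier (C.rtc R12 R34) hA).core V c) (C.pointedCore R12 R34 hA V c)
    (InfinitePlace (L : Type)) kind lam hlam (pinnedVacs kind (R34 V c).m₁ (R34 V c).m₂)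
    (C.chart34 R34 V c kind lam hlam)

namespace OpOrbitCore12

variable {C R12 R34 hA} {L : CMField} {ι₁ : L →+* ℂ} {V : HermSpace3 L ι₁} {c : SeesawCtx L}

/-- pv06-g6's D7-free chart on the end state, pair (12): N21 := node #2's theorem `invariance`. -/
def toOrbitCore (A : OpOrbitCore12 C R12 R34 hA V c) :
    OrbitCore ((ThetaModel.ofRegCarrier (C.rtc R12 R34) hA).core V c) (C.pointedCore R12 R34 hA V c) :=
  letI := A.decEq
  A.side.toOrbitCore (C.invariance R12 R34 hA V c)

/-- **Lemma 4.1(c), pair (12), on the END STATE from the D7-free operator-side core alone**: N21 := node #2 `invariance`,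
the occurrence := node #1 `t12_wOccurs_of_printedEigenvector`; conclusion literally `(T∘.t12 V c).wOccurs i`. -/
theorem H_occ (A : OpOrbitCore12 C R12 R34 hA V c) :
    ∀ (Φ : (ThetaModel.ofRegCarrier (C.rtc R12 R34) hA).SK V c)
      (i : (ThetaModel.ofRegCarrier (C.rtc R12 R34) hA).SigIdx V c),
      (∃ v ∈ ((ThetaModel.ofRegCarrier (C.rtc R12 R34) hA).core V c).hatσ i,
        ((ThetaModel.ofRegCarrier (C.rtc R12 R34) hA).core V c).TΦ Φ v ≠ 0) →
      ((ThetaModel.ofRegCarrier (C.rtc R12 R34) hA).t12 V c).wOccurs i :=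
  letI := A.decEq
  A.side.occ_of_wOccurs (C.invariance R12 R34 hA V c)
    (C.t12_wOccurs_of_printedEigenvector R12 R34 V c A.kind A.lam A.hlam hA)

/-- **Node #3's operator-side printed core gives this one** (forgetful `OpAnalyticSide.toOrbit`). -/
def ofOp (B : OpPrintedCore12 C R12 R34 hA V c) : OpOrbitCore12 C R12 R34 hA V c :=
  letI := B.decEq
  { decEq := B.decEq
    kind := B.kind
    lam := B.lam
    hlam := B.hlam
    side := B.side.toOrbit }

end OpOrbitCore12

namespace OpOrbitCore34

variable {C R12 R34 hA} {L : CMField} {ι₁ : L →+* ℂ} {V : HermSpace3 L ι₁} {c : SeesawCtx L}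

/-- pv06-g6's D7-free chart on the end state, pair (34). -/
def toOrbitCore (A : OpOrbitCore34 C R12 R34 hA V c) :
    OrbitCore ((ThetaModel.ofRegCarrier (C.rtc R12 R34) hA).core V c) (C.pointedCore R12 R34 hA V c) :=
  letI := A.decEq
  A.side.toOrbitCore (C.invariance R12 R34 hA V c)

/-- **Lemma 4.1(c), pair (34), on the END STATE from the D7-free operator-side core alone.** -/
theorem H_occ (A : OpOrbitCore34 C R12 R34 hA V c) :
    ∀ (Φ : (ThetaModel.ofRegCarrier (C.rtc R12 R34) hA).SK V c)
      (i : (ThetaModel.ofRegCarrier (C.rtc R12 R34) hA).SigIdx V c),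
      (∃ v ∈ ((ThetaModel.ofRegCarrier (C.rtc R12 R34) hA).core V c).hatσ i,
        ((ThetaModel.ofRegCarrier (C.rtc R12 R34) hA).core V c).TΦ Φ v ≠ 0) →
      ((ThetaModel.ofRegCarrier (C.rtc R12 R34) hA).t34 V c).wOccurs i :=
  letI := A.decEq
  A.side.occ_of_wOccurs (C.invariance R12 R34 hA V c)
    (C.t34_wOccurs_of_printedEigenvector R12 R34 V c A.kind A.lam A.hlam hA)


-- port_pkg: scope closed for this part
end OpOrbitCore34
end OpenOcc
end AdelicTorusCore
end Universe
end HodgeCM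
end
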